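import Mathlib
import Summits.NavierStokesRegularity.NavierStokesRegularity.Theorems.SubOnsagerCeilingKPSideBranchClassEnvelopes
import Summits.NavierStokesRegularity.NavierStokesRegularity.Theorems.SubcriticalEnvelopeForwardSourceTailEnvelopeKPSShellBarrier
import HarnessLib

/-!
# `ForwardTailCeilingKP` HOLDS ON THE SIDE-BRANCH CLASS at every scale ratio `1 + ε₀ ∈ [1.9, 2]`
(rung under crux stmt-NavierStokesRegularity-27057 `SubOnsagerCeiling.ForwardTailCeilingKP`,
`--supports … --as helper`; LEAD SOC census v6 §C — the joint-region rung)

THE CLASS: KP networks proper of `E₂(R)` (symmetric, cancelling, comparable; orthant; diagonal feeds) whose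
couplings are exactly the Katz–Pavlović chain `0 → 0` (weight `c₀ > 0`), the in-shell pump `0 → 1`
(weight `P ≥ 0`) and the exit feed `1 → 2` (weight `f > 0`) into the DEAD-END pocket `2` — the
architecture of the 25507 witness `sideBranchTable` — with the weights in the certified range
`13P² < f²κ⁴`, `5Pκ(1+ε₀)^{5/2} ≤ c₀(1+ε₀)^{2θ}`, `P(1+ε₀)^{5/2} ≤ 2c₀(1+ε₀)^{2θ}` for some `κ > 0`
(`θ = 101/200`; e.g. `c₀ = f = 1`, `P ≤ 7/100`).

RESULT (`sideClass_fwdCeilingKP`): for such a table and every `ε₀ ∈ [9/10, 1]` the per-table body of the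
crux `ForwardTailCeilingKP` holds with the forward-source set `S = {0, 1}` (which contains every
syntactic forward source of the class), `θ = 101/200 > 1/2` and an explicit `C`: along every honest
non-negative `ν`-viscous solution from any one-shell datum, for every `ν > 0`,
`Σ_{k=n..N} Σ_{i∈{0,1}} ½X_{i,k}(t)² ≤ C·E₀·(1+ε₀)^{-2θn}`.  Proof: `sideClass_envelopes` (the joint
bootstrap, p-pending) gives the weighted per-mode barrier with `D = 101 + 100κ²`; senv-p1's geometric glue
`sTailCeiling_of_sShellBarrier_solutions` (p626948) turns it into the tail ceiling.

WHY IT MATTERS (honest): this is the first KP-proper class WITH A DEAD-END POCKET for which the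
FORWARD-SOURCE ceiling of 27057 is in the kernel — on the very architecture whose TOTAL tail ceiling
(25507) is refuted in numerics (the pocket integrates the wake, Θ → 5/9): the formal content of «dead
ends are not forward sources». It is a RUNG (weights in a smallness range, large scale ratios), not the
crux: general KP networks proper and all `ε₀ ∈ (0, 1]` remain OPEN. MODEL lattice only; nothing here bears
on Navier–Stokes regularity.
-/

noncomputable section

-- the sub-problem namespace `NavierStokesRegularity.NavierStokesRegularity` is the tree's layout (D-0017)
set_option linter.dupNamespace false

namespace Summit.NavierStokesRegularity.NavierStokesRegularity.Theorems

open Set Filter Topology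
open Literature.Analysis.FluidPDE.TaoCascade

/-- In the side-branch class the components `2, 3` are not forward sources. [this file] -/
theorem sideClass_sources {α : Fin 4 → Fin 4 → Fin 4 → ℤ × ℤ × ℤ → ℝ} {c₀ f : ℝ}
    (hD : ∀ a b i : Fin 4, a ≠ b → α a b i (0, 0, 1) = 0)
    (hw : ∀ a c : Fin 4, α a a c (0, 0, 1) = (if a = 0 ∧ c = 0 then c₀ else 0) + (if a = 1 ∧ c = 2 then f else 0)) :
    ∀ i : Fin 4, i ∉ ({0, 1} : Finset (Fin 4)) → ∀ j l : Fin 4, α i j l (0, 0, 1) = 0 := by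
  intro i hi j l
  have hi0 : i ≠ 0 := fun h => hi (by simp [h])
  have hi1 : i ≠ 1 := fun h => hi (by simp [h])
  by_cases hij : i = j
  · subst hij
    rw [hw]
    simp [hi0, hi1]
  · exact hD i j l hij

/-- **`ForwardTailCeilingKP` ON THE SIDE-BRANCH CLASS, `1 + ε₀ ∈ [1.9, 2]`** (see the module docstring): the
per-table body of the crux with `S = {0,1}`, `θ = 101/200`. MODEL lattice statement. [this file] -/
theorem sideClass_fwdCeilingKP (R : ℝ) {ε₀ c₀ P f κ : ℝ} (hε : 9 / 10 ≤ ε₀) (hε1 : ε₀ ≤ 1)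
    {α : Fin 4 → Fin 4 → Fin 4 → ℤ × ℤ × ℤ → ℝ}
    (hw : ∀ a c : Fin 4, α a a c (0, 0, 1) = (if a = 0 ∧ c = 0 then c₀ else 0) + (if a = 1 ∧ c = 2 then f else 0))
    (hP : ∀ a c : Fin 4, a ≠ c → α a a c (0, 0, 0) = if a = 0 ∧ c = 1 then P else 0)
    (hCz : ∀ a b c : Fin 4, a ≠ b → a ≠ c → b ≠ c → α a b c (0, 0, 0) = 0)
    (hc₀ : 0 < c₀) (hP0 : 0 ≤ P) (hf : 0 < f) (hκ : 0 < κ)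
    (hpair : 13 * P ^ 2 < f ^ 2 * κ ^ 4)
    (hdrain : 5 * P * κ * (1 + ε₀) ^ ((5 : ℝ) / 2) ≤ c₀ * ((1 + ε₀) ^ ((101 : ℝ) / 200)) ^ 2)
    (hP1 : P * (1 + ε₀) ^ ((5 : ℝ) / 2) ≤ 2 * c₀ * ((1 + ε₀) ^ ((101 : ℝ) / 200)) ^ 2) :
    Literature.Analysis.FluidPDE.TaoCascade.InTableClass R α →
    (∀ (Y : Fin 4 → ℤ → ℝ → ℝ) (τ : ℝ), (∀ (j : Fin 4) (k : ℤ), 1 ≤ k → 0 ≤ Y j k τ) → ∀ δ : ℝ, 0 < δ →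
      ∀ (i : Fin 4) (n : ℤ), 1 ≤ n → Y i n τ = 0 → 0 ≤ quadTerm δ α Y i n τ) →
    (∀ a b i : Fin 4, a ≠ b → α a b i (0, 0, 1) = 0) →
    ∃ S : Finset (Fin 4), (∀ i, i ∉ S → ∀ j l : Fin 4, α i j l (0, 0, 1) = 0) ∧
      ∃ θ : ℝ, 1 / 2 < θ ∧ ∃ C : ℝ, 0 ≤ C ∧ ∀ ν : ℝ, 0 < ν → ∀ (X₀ : Fin 4 → ℝ) (s : ℝ), 0 < s →
        ∀ X : Fin 4 → ℤ → ℝ → ℝ, (∀ (i : Fin 4) (k : ℤ), X i k 0 = if k = 0 then X₀ i else 0) →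
        (∀ (i : Fin 4) (k : ℤ), k < 0 → ∀ t : ℝ, X i k t = 0) →
        (∃ M : ℝ, ∀ (t : ℝ) (i : Fin 4) (k : ℤ), (1 + (1 + ε₀) ^ ((10 : ℝ) * k)) * |X i k t| ≤ M) →
        (∀ (i : Fin 4) (k : ℤ), Continuous (X i k)) →
        (∀ (i : Fin 4) (k : ℤ), ∀ t ∈ Set.Icc (0 : ℝ) s, HasDerivWithinAt (X i k)
          (quadTerm ε₀ α X i k t - ν * (1 + ε₀) ^ ((2 : ℝ) * k) * X i k t) (Set.Icc (0 : ℝ) s) t) →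
        (∀ t ∈ Set.Icc (0 : ℝ) s, ∀ (i : Fin 4) (k : ℤ), 1 ≤ k → 0 ≤ X i k t) →
        ∀ n N : ℕ, n ≤ N → ∀ t ∈ Set.Icc (0 : ℝ) s,
          ∑ k ∈ Finset.Icc n N, ∑ i ∈ S, (1 / 2 : ℝ) * X i (k : ℤ) t ^ 2 ≤
            C * (∑ i : Fin 4, (1 / 2 : ℝ) * X₀ i ^ 2) * (1 + ε₀) ^ (-(2 * θ * (n : ℝ))) := by
  intro hT hO hD
  obtain ⟨hsy, hc, _⟩ := hT
  have hε0 : 0 < ε₀ := by linarith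
  have hb0 : (0 : ℝ) < 1 + ε₀ := by linarith
  refine ⟨{0, 1}, sideClass_sources hD hw, 101 / 200, by norm_num, ?_⟩
  -- the weighted per-mode barrier on `S = {0,1}` with `D = 101 + 100κ²`
  have H : ∀ ν : ℝ, 0 < ν → ∀ (X₀ : Fin 4 → ℝ) (s : ℝ), 0 < s → ∀ X : Fin 4 → ℤ → ℝ → ℝ,
      (∀ (i : Fin 4) (k : ℤ), X i k 0 = if k = 0 then X₀ i else 0) →
      (∀ (i : Fin 4) (k : ℤ), k < 0 → ∀ t : ℝ, X i k t = 0) →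
      (∃ M : ℝ, ∀ (t : ℝ) (i : Fin 4) (k : ℤ), (1 + (1 + ε₀) ^ ((10 : ℝ) * k)) * |X i k t| ≤ M) →
      (∀ (i : Fin 4) (k : ℤ), Continuous (X i k)) →
      (∀ (i : Fin 4) (k : ℤ), ∀ t ∈ Icc (0 : ℝ) s, HasDerivWithinAt (X i k)
        (quadTerm ε₀ α X i k t - ν * (1 + ε₀) ^ ((2 : ℝ) * k) * X i k t) (Icc (0 : ℝ) s) t) →
      (∀ t ∈ Icc (0 : ℝ) s, ∀ (i : Fin 4) (k : ℤ), 1 ≤ k → 0 ≤ X i k t) →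
      ∀ t ∈ Icc (0 : ℝ) s, ∀ i ∈ ({0, 1} : Finset (Fin 4)), ∀ k : ℕ,
        (1 + ε₀) ^ (2 * (101 / 200 : ℝ) * (k : ℝ)) * ((1 / 2 : ℝ) * X i (k : ℤ) t ^ 2) ≤
          (101 + 100 * κ ^ 2) * (∑ j : Fin 4, (1 / 2 : ℝ) * X₀ j ^ 2) := by
    intro ν hν X₀ s hs X hX0 hvan hbdd hXc hode hnn t ht i hi k
    obtain ⟨M, hM⟩ := hbdd
    set E₀ : ℝ := ∑ j : Fin 4, (1 / 2 : ℝ) * X₀ j ^ 2 with hE₀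
    have hE₀0 : 0 ≤ E₀ := Finset.sum_nonneg fun j _ => by positivity
    have henv := sideClass_envelopes hε hε1 hν hs hsy hc hO hD hw hP hCz hc₀ hP0 hf hκ hpair hdrain hP1
      hX0 hvan ⟨M, hM⟩ hXc hode hnn t ht
    -- the weight as a natural power
    have hwt : (1 + ε₀) ^ (2 * (101 / 200 : ℝ) * (k : ℝ)) = ((1 + ε₀) ^ ((101 : ℝ) / 200)) ^ (2 * k) := by
      rw [← Real.rpow_mul_natCast hb0.le]; congr 1; push_cast; ring
    rw [hwt]
    have hmode := sideClass_mode_le_energy hε0 hν hc hX0 hvan hM hode ht i k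
    simp only [Finset.mem_insert, Finset.mem_singleton] at hi
    rcases hi with rfl | rfl
    · -- the chain component
      have h := henv.1 k
      nlinarith [sq_nonneg κ]
    · -- the side source
      rcases Nat.eq_zero_or_pos k with hk0 | hk
      · subst hk0
        simp only [Nat.cast_zero, mul_zero, pow_zero, one_mul]
        nlinarith [sq_nonneg κ]
      · have h := henv.2 k hk
        nlinarith [sq_nonneg κ]
  obtain ⟨C, hC0, hC⟩ := sTailCeiling_of_sShellBarrier_solutions (α := α) hε0 (by norm_num : (0 : ℝ) < 101 / 200)
    (by positivity : (0 : ℝ) ≤ 101 + 100 * κ ^ 2) ({0, 1} : Finset (Fin 4)) H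
  exact ⟨C, hC0, hC⟩

end Summit.NavierStokesRegularity.NavierStokesRegularity.Theorems

end
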